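import Summits.AtomisticToContinuum.HydrodynamicLimit.Theorems.MourreKoopmanChargesLinearToEntropyInBandDefs
import Summits.AtomisticToContinuum.HydrodynamicLimit.Theorems.MourreKoopmanChargesLinearToEntropyInBandFastCollisionThroughputOfEnvelope
import Summits.AtomisticToContinuum.HydrodynamicLimit.Theorems.InformationPercolationEngineCollisionRateEnvelopeBoundConst
import HarnessLib

/-!
# Route `MourreKoopmanCharges`, crux `LinearToEntropyInBand` (stmt-AtomisticToContinuum-17740), line `registered`:
# stub 3 `stub_fastCollisionThroughputInBand` — part B: the guarded stub from `LanfordEnvelopeR`, and the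
# constant-profile sanity twin (wave 2)

Stub 3 of the skeleton is the packing-guarded vanishing fast-collision throughput
`LTEInBand.FastCollisionThroughputInBand` (`∃ η > 0, FastCollisionThroughputBelow η`), the guarded — hence
weaker — form of the shared typed crux `BallwiseInvariantReferences.FastCollisionThroughput`
(stmt-AtomisticToContinuum-13022).  Part A (`…FastCollisionThroughputOfEnvelope`) landed the by-name reduction
`glue_fastCollisionThroughput_of_lanfordEnvelopeR : LanfordEnvelopeR → FastCollisionThroughput` of the crux to
the open item `Theses.BGEndpointRigidity.LanfordEnvelopeR` (stmt-13677) through the landed marginal-envelope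
machinery of crux `CollisionRate` and the crux body at a fixed profile,
`fastCollisionThroughputAt_of_pairEnvelope`.  Here:

* `glue_fastCollisionThroughputInBand_of_lanfordEnvelopeR : LanfordEnvelopeR → FastCollisionThroughputInBand`
  — the registered wave-2 glue stub of stmt-17740 for stub 3 (via `fastCollisionThroughputInBand_of_unguarded`,
  `η := 1`; the packing guard `ρ_t(x)σ³ < η` constrains only the Euler solution, which neither the crux's
  conclusion nor the head mentions, so it buys nothing on this chain);
* `fastCollisionThroughput_const` — the SANITY TWIN: at CONSTANT profiles (`a₀ ≡ a > 0`, `u₀ ≡ ū`,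
  `θ₀ ≡ θ̄ > 0`; the local Gibbs law is then the flow-invariant canonical law, and every constant state is a
  classical Euler solution) the crux body holds OUTRIGHT with `σ₀ = min σ₀(ū, θ̄) 1/2`: the envelope of the
  evolved equilibrium law holds at all times (`CollisionRate.stub_envelopeBound_const`, BGSR 2016
  Prop. 3.2/4.1 with GST 2013 Prop. 6.1.2), hence (A) (`CollisionRate.marginalEnvelope_of_envelopeOn`) and the
  body (`fastCollisionThroughputAt_of_pairEnvelope`).  No equilibrium estimate is missing.

References: T. Bodineau, I. Gallagher, L. Saint-Raymond, Invent. Math. 203 (2016), Prop. 3.2/4.1;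
I. Gallagher, L. Saint-Raymond, B. Texier, *From Newton to Boltzmann* (2013), Prop. 6.1.2;
C. Cercignani, R. Illner, M. Pulvirenti, *The Mathematical Theory of Dilute Gases* (1994), App. 4.A.
-/

noncomputable section

open MeasureTheory Filter Set Topology
open scoped ENNReal InnerProductSpace BigOperators

namespace Summit.AtomisticToContinuum.HydrodynamicLimit.Theorems.LTEInBand

open Literature.Analysis.FluidPDE Literature.MathematicalPhysics.KineticTheory
open Summit.AtomisticToContinuum.HydrodynamicLimit.Theses

/-- **Wave-2 glue of stub 3 of crux stmt-AtomisticToContinuum-17740, BY NAME**: the open head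
`Theses.BGEndpointRigidity.LanfordEnvelopeR` (stmt-13677) implies the packing-guarded stub statement
`FastCollisionThroughputInBand` (through the unguarded crux, `glue_fastCollisionThroughput_of_lanfordEnvelopeR`,
and `fastCollisionThroughputInBand_of_unguarded`; the guard is not used). -/
theorem glue_fastCollisionThroughputInBand_of_lanfordEnvelopeR : Summit.AtomisticToContinuum.HydrodynamicLimit.Theses.BGEndpointRigidity.LanfordEnvelopeR → Summit.AtomisticToContinuum.HydrodynamicLimit.Theorems.LTEInBand.FastCollisionThroughputInBand :=
  fun hL => fastCollisionThroughputInBand_of_unguarded (glue_fastCollisionThroughput_of_lanfordEnvelopeR hL)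

/-- **The sanity twin at CONSTANT profiles holds outright.** For constant profiles `a₀ ≡ a > 0`,
`u₀ ≡ ū`, `θ₀ ≡ θ̄ > 0` (global equilibrium with a drift; the local Gibbs law is then the flow-invariant
canonical Gibbs law) the body of `FastCollisionThroughput` holds with `σ₀ = min σ₀(ū, θ̄) 1/2`: the
envelope of the (stationary) evolved law holds at all times (`CollisionRate.stub_envelopeBound_const`,
BGSR 2016 Prop. 3.2/4.1 with GST 2013 Prop. 6.1.2), hence (A) (`CollisionRate.marginalEnvelope_of_envelopeOn`)
and the crux body (`fastCollisionThroughputAt_of_pairEnvelope`). -/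
theorem fastCollisionThroughput_const (a θb : ℝ) (ub : V3) (ha : 0 < a) (hθb : 0 < θb) :
    ∃ σ₀ : ℝ, 0 < σ₀ ∧ ∀ σ : ℝ, 0 < σ → σ < σ₀ → ∀ (T : ℝ) (ρ θ : ℝ → T3 → ℝ) (u : ℝ → T3 → V3),
      IsHardSphereEulerSolution σ T ρ u θ →
      ∀ Φ : (N : ℕ) → HardSphereFlow (Torus.geometry (Fin 3)) (hsDiameter σ N) (N + 1),
        TendstoHydroFieldsAt (fun N => localGibbsLaw σ (fun _ => a) (fun _ => ub) (fun _ => θb) N (Φ N)) Φ ρ u θ 0 →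
        ∀ t ∈ Set.Ico 0 T, ∀ η : ℝ, 0 < η → ∃ K : ℝ, ∃ N₀ : ℕ, ∀ N : ℕ, N₀ ≤ N →
          ∫⁻ z, ENNReal.ofReal ((((N : ℝ) + 1) ^ (-(4 / 3 : ℝ))) * ∑ i : Fin (N + 1), ∑ᶠ s ∈ Literature.Analysis.FluidPDE.collisionTimes (Literature.Analysis.FluidPDE.Torus.geometry (Fin 3)) (Literature.MathematicalPhysics.KineticTheory.hsDiameter σ N) (fun s => (Φ N).flow s z) ∩ Set.Ioc 0 t, (if K < max ‖(Function.leftLim (fun s => (Φ N).flow s z) s i).2‖ ‖((Φ N).flow s z i).2‖ then (1 + ‖((Φ N).flow s z i).2 + (Function.leftLim (fun s => (Φ N).flow s z) s i).2‖ / 2) * ‖((Φ N).flow s z i).2 - (Function.leftLim (fun s => (Φ N).flow s z) s i).2‖ else 0)) ∂(Literature.MathematicalPhysics.KineticTheory.localGibbsLaw σ (fun _ => a) (fun _ => ub) (fun _ => θb) N (Φ N)) ≤ ENNReal.ofReal η := by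
  obtain ⟨σ₁, hσ₁, hE⟩ := CollisionRate.stub_envelopeBound_const a θb ub ha hθb
  refine ⟨min σ₁ 2⁻¹, lt_min hσ₁ (by norm_num), ?_⟩
  refine fastCollisionThroughputAt_of_pairEnvelope (a₀ := fun _ => a) (θ₀ := fun _ => θb) (u₀ := fun _ => ub)
    (σ₀ := min σ₁ 2⁻¹) fun σ hσ hσlt Φ τ _hτ => ?_
  obtain ⟨β, C, hβ, hC, hB⟩ := hE σ hσ (hσlt.trans_le (min_le_left _ _))
  have hEnv : CollisionActivityTailsEnvelopePlumbing.EnvelopeOn σ (fun _ => a) (fun _ => θb) (fun _ => ub) Φ τ β C :=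
    fun N k r _ => hB N (Φ N) k r
  obtain ⟨C', hC', u, θ, hθ, N₀, hN⟩ := CollisionRate.marginalEnvelope_of_envelopeOn
    (a₀ := fun _ => a) (θ₀ := fun _ => θb) (u₀ := fun _ => ub) continuous_const continuous_const
    continuous_const (fun _ => ha) (fun _ => hθb) hσ (hσlt.trans_le (min_le_right _ _)) Φ hβ hC hEnv
  exact ⟨C', hC', u, θ, hθ, N₀, fun N hNN t ht => (hN N hNN t ht).1⟩

end Summit.AtomisticToContinuum.HydrodynamicLimit.Theorems.LTEInBand

end
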